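import Literature.NumberTheory.ModularForms.Gamma0FreeModNegOne
import Literature.GroupTheory.SpecificGroups.ModularGroupFreeProduct
import Literature.GroupTheory.CombinatorialGroupTheory.AmalgamFreeSubgroups
import Literature.NumberTheory.EllipticCurves.PeterssonNormLowerBoundProofs
import Literature.NumberTheory.EllipticCurves.ModularCurveEllipticPointsProofs
import Summits.BirchSwinnertonDyer.BirchSwinnertonDyer.Theorems.ManinLocalTwoThreeParabolicElements
import HarnessLib

/-!
# `Γ₀(M) = {±1} × (free group)` for `9 ∣ M` — PROOF of the named fact `gamma0_eq_negOne_prod_free_of_nine_dvd`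
# (route `ManinLocalTwoThree`, cell bsd-f2-manin; crux C3 `ManinPrimeToThreeAtNine` stmt-BirchSwinnertonDyer-22968; prover seat p3 gen 10)

Discharges the statement-only Literature fact `Literature.NumberTheory.ModularForms.gamma0_eq_negOne_prod_free_of_nine_dvd`
(`Gamma0FreeModNegOne.lean`, E-es-108 of the cell = the single printed input of the Heisenberg-lift route to E-es-98/106,
Kulkarni 1991 Thm. 3.2–3.3 / Kurosh).  The tree already holds everything needed:
* `Literature.GroupTheory.SpecificGroups.ModularGroupFreeProduct`: `PSL₂(ℤ) ≅ ℤ/2 ∗ ℤ/3` by ping-pong —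
  `fromSL : SL(2, ℤ) →* FP` (`FP = CoprodI Fac`), surjective, `fromSL g = 1 ↔ g` acts trivially on `ℍ`;
* `Literature.GroupTheory.CombinatorialGroupTheory.isFreeGroup_of_disjoint_conjugates'` (Cohen, *Combinatorial
  group theory*, Ch. 8 Thm. 27 Cor. 2): a subgroup of an amalgam `∗_H Gᵢ` meeting no conjugate of a factor is FREE.
What this file adds (the kernel of `SL(2, ℤ)` on `ℍ` being `{±1}` is the tree's `SL2Z_eq_one_or_neg_one_of_forall_smul_eq`): (§2) for `9 ∣ M` no element of `Γ₀(M)` has trace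
`0` or `±1` (`ad ≡ 1 (mod 9)`), so no conjugate of `S`, `U`, `U²` lies in `Γ₀(M)`; (§3) `ℤ/2 ∗ ℤ/3` as Mathlib's
`Monoid.PushoutI` over the trivial group (to apply the amalgam theorem); (§4) the image of `Γ₀(M)` in `ℤ/2 ∗ ℤ/3` is
free, a free basis lifts into `Γ₀(M)`, and `Γ₀(M) = {±1}·e(FreeGroup ι)` with unique decomposition
(**`gamma0_eq_negOne_prod_free_of_nine_dvd_holds`**).

References: R. S. Kulkarni, Amer. J. Math. 113 (1991) 1053–1133, Thms. 3.2–3.3; A. G. Kurosh, *Theory of groups* II §34;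
D. E. Cohen, *Combinatorial Group Theory* (1989), Ch. 8; F. Diamond, J. Shurman, *A first course in modular forms*,
Cor. 3.7.2 (no elliptic points for `9 ∣ M`).
-/

set_option autoImplicit false
set_option linter.dupNamespace false

open scoped MatrixGroups UpperHalfPlane

open CongruenceSubgroup Matrix.SpecialLinearGroup ModularGroup
open Literature.GroupTheory.SpecificGroups Literature.GroupTheory.SpecificGroups.ModularGroupFreeProduct
open Literature.GroupTheory.CombinatorialGroupTheory

namespace Summit.BirchSwinnertonDyer.BirchSwinnertonDyer.Theorems.ManinLocalTwoThree

namespace Gamma0Free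

/-! ### §1. The kernel of the action of `SL(2, ℤ)` on `ℍ` is `{±1}`: the tree's
`Literature.NumberTheory.EllipticCurves.ModularForms.SL2Z_eq_one_or_neg_one_of_forall_smul_eq` -/

/-! ### §2. `9 ∣ M`: no element of `Γ₀(M)` has trace `0` or `±1` -/

/-- In `ℤ/9`: `ad = 1` forces `a + d ∉ {0, 1, −1}`. [folklore] -/
theorem zmod9_trace (a d : ZMod 9) (h : a * d = 1) : a + d ≠ 0 ∧ a + d ≠ 1 ∧ a + d ≠ -1 := by
  revert a d h
  decide

/-- **No elliptic traces in `Γ₀(M)`, `9 ∣ M`**: `a + d ≠ 0, ±1`. [cite: DiamondShurman2005, Cor. 3.7.2] -/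
theorem trace_ne_of_nine_dvd {M : ℕ} (hM : 9 ∣ M) (γ : SL(2, ℤ)) (hγ : γ ∈ Gamma0 M) :
    (γ 0 0 : ℤ) + γ 1 1 ≠ 0 ∧ (γ 0 0 : ℤ) + γ 1 1 ≠ 1 ∧ (γ 0 0 : ℤ) + γ 1 1 ≠ -1 := by
  have hc : (9 : ℤ) ∣ (γ 1 0 : ℤ) := by
    have hcM : (M : ℤ) ∣ (γ 1 0 : ℤ) := (ZMod.intCast_zmod_eq_zero_iff_dvd _ _).mp (Gamma0_mem.mp hγ)
    exact (Int.natCast_dvd_natCast.mpr hM).trans hcM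
  have hdet : (γ 0 0 : ℤ) * γ 1 1 - (γ 0 1 : ℤ) * γ 1 0 = 1 := by
    have := Matrix.det_fin_two (γ : Matrix (Fin 2) (Fin 2) ℤ)
    rw [γ.2] at this
    exact this.symm
  have hc9 : (((γ 1 0 : ℤ) : ZMod 9)) = 0 := by
    rw [ZMod.intCast_zmod_eq_zero_iff_dvd]; exact_mod_cast hc
  have h9 : ((γ 0 0 : ℤ) : ZMod 9) * ((γ 1 1 : ℤ) : ZMod 9) = 1 := by
    have := congrArg (Int.cast : ℤ → ZMod 9) hdet
    push_cast at this
    rw [hc9, mul_zero, sub_zero] at this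
    exact this
  obtain ⟨h0, h1, h2⟩ := zmod9_trace _ _ h9
  refine ⟨fun h => h0 ?_, fun h => h1 ?_, fun h => h2 ?_⟩
  · have := congrArg (Int.cast : ℤ → ZMod 9) h; push_cast at this; exact this
  · have := congrArg (Int.cast : ℤ → ZMod 9) h; push_cast at this; exact this
  · have := congrArg (Int.cast : ℤ → ZMod 9) h; push_cast at this; exact this

/-- The trace of a conjugate. [folklore] -/
theorem trace_conj (δ X : SL(2, ℤ)) :
    ((δ⁻¹ * X * δ : SL(2, ℤ)) 0 0 : ℤ) + (δ⁻¹ * X * δ : SL(2, ℤ)) 1 1 = (X 0 0 : ℤ) + X 1 1 := by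
  have h1 : Matrix.trace ((δ⁻¹ * X * δ : SL(2, ℤ)) : Matrix (Fin 2) (Fin 2) ℤ) =
      Matrix.trace ((X : SL(2, ℤ)) : Matrix (Fin 2) (Fin 2) ℤ) := by
    rw [Matrix.SpecialLinearGroup.coe_mul, Matrix.SpecialLinearGroup.coe_mul, Matrix.trace_mul_cycle,
      ← Matrix.SpecialLinearGroup.coe_mul, mul_inv_cancel, Matrix.SpecialLinearGroup.coe_one, one_mul]
  rw [Matrix.trace_fin_two, Matrix.trace_fin_two] at h1
  exact h1

/-- No conjugate of an element of trace `0` or `±1` lies in `±Γ₀(M)`, `9 ∣ M`. [cite: DiamondShurman2005, Cor. 3.7.2] -/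
theorem conj_not_mem_of_trace {M : ℕ} (hM : 9 ∣ M) (X δ : SL(2, ℤ))
    (hX : (X 0 0 : ℤ) + X 1 1 = 0 ∨ (X 0 0 : ℤ) + X 1 1 = 1 ∨ (X 0 0 : ℤ) + X 1 1 = -1)
    (s : SL(2, ℤ)) (hs : s = 1 ∨ s = -1) : ¬ (s * (δ⁻¹ * X * δ) ∈ Gamma0 M) := by
  intro hmem
  have hmem' : δ⁻¹ * X * δ ∈ Gamma0 M := by
    rcases hs with rfl | rfl
    · simpa using hmem
    · have := (Gamma0 M).mul_mem (neg_one_mem_Gamma0 M) hmem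
      simpa [← mul_assoc] using this
  obtain ⟨h0, h1, h2⟩ := trace_ne_of_nine_dvd hM _ hmem'
  rw [trace_conj] at h0 h1 h2
  rcases hX with h | h | h
  · exact h0 h
  · exact h1 h
  · exact h2 h

/-! ### §3. `ℤ/2 ∗ ℤ/3` as an amalgam over the trivial group -/

/-- The trivial structure maps `1 → ℤ/2`, `1 → ℤ/3`. [folklore] -/
def φ₀ (b : Bool) : (PUnit : Type) →* Fac b := 1

/-- `ℤ/2 ∗_{1} ℤ/3` (Mathlib's `PushoutI` over the trivial group). [folklore] -/
abbrev P : Type := Monoid.PushoutI φ₀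

/-- `FP → P`. [folklore] -/
def toP : FP →* P := Monoid.PushoutI.ofCoprodI

/-- `P → FP`. [folklore] -/
def fromP : P →* FP :=
  Monoid.PushoutI.lift (fun b => (Monoid.CoprodI.of : Fac b →* FP)) 1 (fun b => by
    ext x
    rw [Subsingleton.elim x 1, map_one, map_one])

/-- `fromP ∘ toP = id`. [folklore] -/
theorem fromP_toP (x : FP) : fromP (toP x) = x := by
  have h : fromP.comp toP = MonoidHom.id FP := by
    refine Monoid.CoprodI.ext_hom _ _ (fun b => ?_)
    ext g
    simp [toP, fromP]
  exact DFunLike.congr_fun h x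

/-- `toP ∘ fromP = id`. [folklore] -/
theorem toP_fromP (x : P) : toP (fromP x) = x := by
  have h : toP.comp fromP = MonoidHom.id P := by
    refine Monoid.PushoutI.hom_ext_nonempty (fun b => ?_)
    ext g
    simp [toP, fromP]
  exact DFunLike.congr_fun h x

/-- `toP` is injective. [folklore] -/
theorem toP_injective : Function.Injective toP :=
  Function.LeftInverse.injective fromP_toP

/-- `toP` is surjective. [folklore] -/
theorem toP_surjective : Function.Surjective toP :=
  Function.RightInverse.surjective toP_fromP

/-! ### §4. The image of `Γ₀(M)` in `ℤ/2 ∗ ℤ/3` is free; lifting a free basis -/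

/-- `SL(2, ℤ) → ℤ/2 ∗_{1} ℤ/3` (kernel `±1`). [cite: SerreTrees1980, I.4.2] -/
noncomputable def FSL : SL(2, ℤ) →* P := toP.comp fromSL

/-- `FSL g = 1 ↔ g = ±1`. [folklore] -/
theorem FSL_eq_one_iff (g : SL(2, ℤ)) : FSL g = 1 ↔ g = 1 ∨ g = -1 := by
  constructor
  · intro h
    have h1 : fromSL g = 1 := toP_injective (by rw [map_one]; exact h)
    exact Literature.NumberTheory.EllipticCurves.ModularForms.SL2Z_eq_one_or_neg_one_of_forall_smul_eq g
      ((fromSL_eq_one_iff g).mp h1)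
  · rintro (rfl | rfl)
    · exact map_one _
    · rw [FSL, MonoidHom.comp_apply, fromSL_neg_one, map_one]

/-- `FSL` is surjective. [folklore] -/
theorem FSL_surjective : Function.Surjective FSL :=
  toP_surjective.comp fromSL_surjective

/-- `FSL (S^n)` is the `n`-th power of the generator of the factor `ℤ/2`. [folklore] -/
theorem FSL_S_pow (n : ℕ) : FSL (S ^ n) = Monoid.PushoutI.of (φ := φ₀) true (genS ^ n) := by
  rw [map_pow, map_pow, FSL, MonoidHom.comp_apply, fromSL_S, inS_def, toP, Monoid.PushoutI.ofCoprodI_of]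

/-- `FSL (U^n)` is the `n`-th power of the generator of the factor `ℤ/3`. [folklore] -/
theorem FSL_U_pow (n : ℕ) : FSL (U ^ n) = Monoid.PushoutI.of (φ := φ₀) false (genU ^ n) := by
  rw [map_pow, map_pow, FSL, MonoidHom.comp_apply, fromSL_U, inU_def, toP, Monoid.PushoutI.ofCoprodI_of]

/-- The image `K(M)` of `Γ₀(M)` in `ℤ/2 ∗ ℤ/3`. [folklore] -/
noncomputable def K (M : ℕ) : Subgroup P := (Gamma0 M).map FSL

/-- Pull-back along `FSL`: `FSL x ∈ K(M) → x ∈ Γ₀(M)` (as `−1 ∈ Γ₀(M)`). [folklore] -/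
theorem mem_Gamma0_of_FSL_mem {M : ℕ} {x : SL(2, ℤ)} (hx : FSL x ∈ K M) : x ∈ Gamma0 M := by
  obtain ⟨γ, hγ, hγx⟩ := Subgroup.mem_map.mp hx
  have h1 : FSL (γ⁻¹ * x) = 1 := by rw [map_mul, map_inv, hγx, inv_mul_cancel]
  rcases (FSL_eq_one_iff _).mp h1 with h | h
  · rw [inv_mul_eq_one] at h
    rw [← h]; exact hγ
  · have hx' : x = γ * -1 := by rw [← h, mul_inv_cancel_left]
    rw [hx']
    exact (Gamma0 M).mul_mem hγ (neg_one_mem_Gamma0 M)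

/-- Traces of `S`, `U`, `U²`. [folklore] -/
theorem traces_S_U : ((S 0 0 : ℤ) + S 1 1 = 0) ∧ ((U 0 0 : ℤ) + U 1 1 = 1) ∧
    (((U ^ 2 : SL(2, ℤ)) 0 0 : ℤ) + (U ^ 2 : SL(2, ℤ)) 1 1 = -1) := by
  refine ⟨by decide, by decide, by decide⟩

/-- **For `9 ∣ M`, `K(M)` meets no conjugate of a factor of `ℤ/2 ∗ ℤ/3`.** [cite: DiamondShurman2005, Cor. 3.7.2] -/
theorem conj_of_mem_K {M : ℕ} (hM : 9 ∣ M) (b : Bool) (g : Fac b) (γ : P)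
    (hmem : γ⁻¹ * Monoid.PushoutI.of (φ := φ₀) b g * γ ∈ K M) : g = 1 := by
  obtain ⟨δ, rfl⟩ := FSL_surjective γ
  obtain ⟨hS, hU, hU2⟩ := traces_S_U
  cases b with
  | true =>
      obtain ⟨n, hn, rfl⟩ := exists_genS_pow g
      interval_cases n
      · rw [pow_zero]
      · exfalso
        rw [← FSL_S_pow, ← map_inv, ← map_mul, ← map_mul] at hmem
        have := mem_Gamma0_of_FSL_mem hmem
        rw [pow_one] at this
        exact conj_not_mem_of_trace hM S δ (Or.inl hS) 1 (Or.inl rfl) (by simpa using this)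
  | false =>
      obtain ⟨n, hn, rfl⟩ := exists_genU_pow g
      interval_cases n
      · rw [pow_zero]
      · exfalso
        rw [← FSL_U_pow, ← map_inv, ← map_mul, ← map_mul] at hmem
        have := mem_Gamma0_of_FSL_mem hmem
        rw [pow_one] at this
        exact conj_not_mem_of_trace hM U δ (Or.inr (Or.inl hU)) 1 (Or.inl rfl) (by simpa using this)
      · exfalso
        rw [← FSL_U_pow, ← map_inv, ← map_mul, ← map_mul] at hmem
        have := mem_Gamma0_of_FSL_mem hmem
        exact conj_not_mem_of_trace hM (U ^ 2) δ (Or.inr (Or.inr hU2)) 1 (Or.inl rfl) (by simpa using this)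

/-- **`K(M)` is a free group for `9 ∣ M`** (Kurosh / Cohen Ch. 8 Thm. 27 Cor. 2 applied to `ℤ/2 ∗ ℤ/3`).
[cite: CohenCGT1989, Ch. 8 Thm. 27 Cor. 2 p.210] -/
theorem isFreeGroup_K {M : ℕ} (hM : 9 ∣ M) : IsFreeGroup (K M) :=
  isFreeGroup_of_disjoint_conjugates' (φ := φ₀) (fun _ _ _ _ => Subsingleton.elim _ _) (K M)
    (fun b g γ h => conj_of_mem_K hM b g γ h)

/-- `FSL (-1) = 1`. [folklore] -/
theorem FSL_neg_one : FSL (-1) = 1 := (FSL_eq_one_iff _).mpr (Or.inr rfl)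

/-- `FSL` kills the sign `±1`. [folklore] -/
theorem FSL_sign (s : Bool) : FSL (if s then (-1 : SL(2, ℤ)) else 1) = 1 := by
  cases s
  · exact map_one _
  · exact FSL_neg_one

end Gamma0Free

open Gamma0Free in
/-- **`Γ₀(M) = {±1} × (free group)` for `9 ∣ M`** — the named fact `gamma0_eq_negOne_prod_free_of_nine_dvd` PROVED:
the image of `Γ₀(M)` in `PSL₂(ℤ) ≅ ℤ/2 ∗ ℤ/3` meets no conjugate of a factor (no traces `0, ±1` when `9 ∣ M`), hence is
free (Kurosh); a free basis lifts into `Γ₀(M)` and every `γ ∈ Γ₀(M)` is `± e(w)` for exactly one `(w, ±)`.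
[cite: Kulkarni1991, Thm. 3.2 and Thm. 3.3] [cite: CohenCGT1989, Ch. 8 Thm. 27 Cor. 2 p.210] -/
theorem gamma0_eq_negOne_prod_free_of_nine_dvd_holds :
    Literature.NumberTheory.ModularForms.gamma0_eq_negOne_prod_free_of_nine_dvd := by
  intro M hM
  haveI : IsFreeGroup (K M) := isFreeGroup_K hM
  -- preimages of the free generators
  have hpre : ∀ i : IsFreeGroup.Generators (K M), ∃ γ : SL(2, ℤ), γ ∈ Gamma0 M ∧
      FSL γ = ((IsFreeGroup.of i : K M) : P) := fun i =>
    Subgroup.mem_map.mp (IsFreeGroup.of i).2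
  choose γs hγs hFγ using hpre
  let e₀ : FreeGroup (IsFreeGroup.Generators (K M)) →* Gamma0 M := FreeGroup.lift (fun i => ⟨γs i, hγs i⟩)
  let e : FreeGroup (IsFreeGroup.Generators (K M)) →* SL(2, ℤ) := (Gamma0 M).subtype.comp e₀
  -- the comparison `FSL ∘ e = subtype ∘ iso⁻¹`
  let iso : (K M) ≃* FreeGroup (IsFreeGroup.Generators (K M)) := IsFreeGroup.toFreeGroup (K M)
  have he_of : ∀ i, e (FreeGroup.of i) = γs i := fun i => by
    show ((e₀ (FreeGroup.of i) : Gamma0 M) : SL(2, ℤ)) = γs i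
    have : e₀ (FreeGroup.of i) = ⟨γs i, hγs i⟩ := FreeGroup.lift_apply_of
    rw [this]
  have hiso : ∀ i, iso.symm (FreeGroup.of i) = IsFreeGroup.of i := fun i => by
    show (IsFreeGroup.toFreeGroup (K M)).symm (FreeGroup.of i) = _
    rw [IsFreeGroup.toFreeGroup, MulEquiv.symm_symm]
    rfl
  have hcomp : FSL.comp e = (K M).subtype.comp iso.symm.toMonoidHom := by
    refine FreeGroup.ext_hom _ _ (fun i => ?_)
    have h1 : (FSL.comp e) (FreeGroup.of i) = FSL (e (FreeGroup.of i)) := rfl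
    have h2 : ((K M).subtype.comp iso.symm.toMonoidHom) (FreeGroup.of i) = ((iso.symm (FreeGroup.of i) : K M) : P) :=
      rfl
    rw [h1, h2, he_of, hFγ, hiso]
  have hcomp' : ∀ w, FSL (e w) = ((iso.symm w : K M) : P) := fun w => DFunLike.congr_fun hcomp w
  refine ⟨IsFreeGroup.Generators (K M), e, fun w => (e₀ w).2, ?_⟩
  intro γ hγ
  -- existence
  set w := iso ⟨FSL γ, Subgroup.mem_map_of_mem FSL hγ⟩ with hw
  have hew : FSL (e w) = FSL γ := by rw [hcomp', hw, MulEquiv.symm_apply_apply]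
  have h1 : FSL ((e w)⁻¹ * γ) = 1 := by rw [map_mul, map_inv, hew, inv_mul_cancel]
  have hex : ∃ s : Bool, γ = (if s then (-1 : SL(2, ℤ)) else 1) * e w := by
    rcases (FSL_eq_one_iff _).mp h1 with h | h
    · exact ⟨false, by rw [inv_mul_eq_one] at h; simpa using h.symm⟩
    · refine ⟨true, ?_⟩
      rw [inv_mul_eq_iff_eq_mul] at h
      rw [h]
      simp
  obtain ⟨s, hs⟩ := hex
  refine ⟨(w, s), hs, ?_⟩
  -- uniqueness
  rintro ⟨w', s'⟩ hs'
  have hww : w' = w := by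
    have h2 : FSL (e w') = FSL (e w) := by
      have a1 := congrArg FSL hs
      have a2 := congrArg FSL hs'
      rw [map_mul, FSL_sign, one_mul] at a1 a2
      rw [← a2, ← a1]
    rw [hcomp', hcomp'] at h2
    exact iso.symm.injective (Subtype.ext h2)
  subst hww
  have hss : (if s' then (-1 : SL(2, ℤ)) else 1) = (if s then (-1 : SL(2, ℤ)) else 1) :=
    mul_right_cancel (hs'.symm.trans hs)
  have : s' = s := by
    cases s <;> cases s'
    · rfl
    · exact absurd hss.symm Literature.NumberTheory.EllipticCurves.ModularForms.SL2Z.one_ne_neg_one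
    · exact absurd hss Literature.NumberTheory.EllipticCurves.ModularForms.SL2Z.one_ne_neg_one
    · rfl
  rw [this]



end Summit.BirchSwinnertonDyer.BirchSwinnertonDyer.Theorems.ManinLocalTwoThree
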